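import Summits.ValiantsHypothesis.ValiantsHypothesis.Theorems.BarrierLeverPartitionMinorsHitByVPRoabpDoorNegativeCut

/-!
# Route BarrierLever — item `PartitionMinorsHitByVP` (stmt-ValiantsHypothesis-19717):
# the ROABP door's conjecture of record is FALSE — `not_ROABPHitsPartitionMinors` (negative edge, part 2)

Helper file (`--supports stmt-ValiantsHypothesis-19717`; cell valiant-natproofs, rung V4, 𝒟-side; prover seat val-np-p7 g15 on
director g8's word (STATUS 2026-08-27 l.827); mathematics = planner p1 g17's memo HOME/p1/g17/MEMO-roabp-refutation-g17.md §§2–3, §7).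
Closes NO item: `RoabpDoor.ROABPHitsPartitionMinors` is a Theorems-side `@[conjecture] def` (p535779), not a ledger item; item 19717
`PartitionMinorsHitByVP` is UNTOUCHED (general circuits are not read-once). The door `partitionMinor_hit_of_roabpCertificate` and
its class theorems (`…RoabpNfa`, transducer layouts) stay valid as CERTIFIED CLASSES.

THEOREM `not_ROABPHitsPartitionMinors : ¬ ROABPHitsPartitionMinors`. Proof (Nisan's width = cut-rank characterization applied
to a one-sided sub-block; [Nisan 1991, STOC, doi:10.1145/103418.103462]; cf. [Jukna 2012, Thm 16.16 / Cor 16.17] for the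
«rich on both sides of every cut» move): given `c, h₀` put `s = 2c+1`, `n ≥ max(h₀, N(c), s)`, height `h = 2n`; rows = ALL
`s`-subsets of the `x`-coordinates (`r = C(2n,s)`), columns = binary codes of `j < r` on the first `k = Nat.clog 2 r ≤ 2n`
`y`-coordinates (`2^k < 2r`). For any order `π` and width-`m` certificate with `det ≠ 0`: cut right after `n` `x`-reads
(`exists_balanced_cut`, discrete IVT); part 1's one-cut bounds (`choose_card_pre_le/suf_le`) give `C(n,s) ≤ m·2^{k₁}`,
`C(n,s) ≤ m·2^{k₂}`, `k₁ + k₂ = k`, hence `C(n,s)² ≤ m²·2^k ≤ 2·(4n)^{2c}·C(2n,s)` for `m ≤ (2h)^c = (4n)^c`, contradicting the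
counting lemma `two_mul_pow_mul_choose_lt` (`2·(4n)^{2c}·C(2n,2c+1) < C(n,2c+1)²` for `n ≥ N(c)`, proved in ℕ via
`s!·C(N,s) = N.descFactorial s`, `descFactorial_le_pow`, `pow_sub_le_descFactorial`).
CONSEQUENCE for the cell (memo §6): every read-once poly-state witness (TT/MPS, transducer/NFA certificates, trellis doors) is
confined to layouts that are not «product-rich across balanced cuts»; thin rows × code columns is the benchmark family.

WHAT THIS IS NOT: not a refutation of item 19717, nothing on crux 14610 or on VP ≠ VNP.
-/
namespace Summit.ValiantsHypothesis.Theorems.BarrierLever.RoabpDoor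

open Matrix Finset

/-! ## A balanced cut exists (discrete intermediate value theorem) -/

/-- For every reading order and every `n ≤ h` there is a time before which exactly `n` of the `x`-coordinates are read. -/
theorem exists_balanced_cut {h : ℕ} (π : Equiv.Perm (Fin (h + h))) (n : ℕ) (hn : n ≤ h) :
    ∃ t₀ : ℕ, (Finset.univ.filter fun a : Fin h => (π.symm (Fin.castAdd h a) : ℕ) < t₀).card = n := by
  classical
  set f : ℕ → ℕ := fun t => (Finset.univ.filter fun a : Fin h => (π.symm (Fin.castAdd h a) : ℕ) < t).card with hf
  have f0 : f 0 = 0 := by simp [hf]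
  have ftop : f (h + h) = h := by
    simp only [hf]
    rw [Finset.filter_true_of_mem fun a _ => (π.symm (Fin.castAdd h a)).is_lt, Finset.card_univ, Fintype.card_fin]
  have fstep : ∀ t, f (t + 1) ≤ f t + 1 := by
    intro t
    simp only [hf]
    have hsub : (Finset.univ.filter fun a : Fin h => (π.symm (Fin.castAdd h a) : ℕ) < t + 1) ⊆
        (Finset.univ.filter fun a : Fin h => (π.symm (Fin.castAdd h a) : ℕ) < t) ∪
          (Finset.univ.filter fun a : Fin h => (π.symm (Fin.castAdd h a) : ℕ) = t) := by
      intro a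
      simp only [Finset.mem_filter, Finset.mem_univ, true_and, Finset.mem_union]
      intro ha; omega
    have hone : (Finset.univ.filter fun a : Fin h => (π.symm (Fin.castAdd h a) : ℕ) = t).card ≤ 1 := by
      refine Finset.card_le_one.2 fun a ha b hb => ?_
      simp only [Finset.mem_filter, Finset.mem_univ, true_and] at ha hb
      have : π.symm (Fin.castAdd h a) = π.symm (Fin.castAdd h b) := Fin.ext (by rw [ha, hb])
      exact Fin.castAdd_injective _ _ (π.symm.injective this)
    calc _ ≤ ((Finset.univ.filter fun a : Fin h => (π.symm (Fin.castAdd h a) : ℕ) < t) ∪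
          (Finset.univ.filter fun a : Fin h => (π.symm (Fin.castAdd h a) : ℕ) = t)).card :=
          Finset.card_le_card hsub
      _ ≤ _ := (Finset.card_union_le _ _).trans (by omega)
  -- discrete IVT
  have ivt : ∀ t, ∀ n ≤ f t, ∃ t₀, f t₀ = n := by
    intro t
    induction t with
    | zero => intro n hn; exact ⟨0, by rw [f0] at hn ⊢; omega⟩
    | succ t ih =>
      intro n hn
      by_cases hle : n ≤ f t
      · exact ih n hle
      · exact ⟨t + 1, by have := fstep t; omega⟩
  exact ivt (h + h) n (by rw [ftop]; exact hn)

/-! ## Counting: for thinness `s = 2c+1` the one-cut bound beats every polynomial width -/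

/-- For `s = 2c + 1` and `n ≥ N(c)`: `2 · (4n)^{2c} · C(2n, s) < C(n, s)²`. -/
theorem two_mul_pow_mul_choose_lt (c : ℕ) :
    ∃ N : ℕ, ∀ n : ℕ, N ≤ n → 2 * (4 * n) ^ (2 * c) * Nat.choose (2 * n) (2 * c + 1) < (Nat.choose n (2 * c + 1)) ^ 2 := by
  set s := 2 * c + 1 with hs
  -- the constant: K = 2^{3s+4c+1} · s!
  refine ⟨max (2 * s) (2 ^ (3 * s + 4 * c + 1) * s.factorial + 1), fun n hn => ?_⟩
  have hn2 : 2 * s ≤ n := le_trans (le_max_left _ _) hn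
  have hnK : 2 ^ (3 * s + 4 * c + 1) * s.factorial < n := Nat.lt_of_lt_of_le (Nat.lt_succ_self _) (le_trans (le_max_right _ _) hn)
  have hnpos : 0 < n := by omega
  have hfact : 0 < s.factorial := Nat.factorial_pos s
  -- (s!)² · LHS ≤ 2 (4n)^{2c} · s! · (2n)^s
  have h1 : s.factorial ^ 2 * (2 * (4 * n) ^ (2 * c) * Nat.choose (2 * n) s) ≤
      2 * (4 * n) ^ (2 * c) * s.factorial * (2 * n) ^ s := by
    have hd : s.factorial * Nat.choose (2 * n) s ≤ (2 * n) ^ s := by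
      rw [← Nat.descFactorial_eq_factorial_mul_choose]; exact Nat.descFactorial_le_pow _ _
    calc s.factorial ^ 2 * (2 * (4 * n) ^ (2 * c) * Nat.choose (2 * n) s)
        = 2 * (4 * n) ^ (2 * c) * s.factorial * (s.factorial * Nat.choose (2 * n) s) := by ring
      _ ≤ 2 * (4 * n) ^ (2 * c) * s.factorial * (2 * n) ^ s := Nat.mul_le_mul_left _ hd
  -- (n+1-s)^{2s} ≤ (s! · C(n,s))²
  have h2 : (n + 1 - s) ^ (2 * s) ≤ (s.factorial * Nat.choose n s) ^ 2 := by
    rw [← Nat.descFactorial_eq_factorial_mul_choose, mul_comm 2 s, pow_mul]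
    exact Nat.pow_le_pow_left (Nat.pow_sub_le_descFactorial n s) 2
  -- the middle inequality: 2 (4n)^{2c} · s! · (2n)^s < (n+1-s)^{2s}
  have h3 : 2 * (4 * n) ^ (2 * c) * s.factorial * (2 * n) ^ s < (n + 1 - s) ^ (2 * s) := by
    have hhalf : n ≤ 2 * (n + 1 - s) := by omega
    have hpow : n ^ (2 * s) ≤ 2 ^ (2 * s) * (n + 1 - s) ^ (2 * s) := by
      rw [← mul_pow]; exact Nat.pow_le_pow_left hhalf _
    -- 2^{2s} · LHS = K · n^{2c+s} < n · n^{2c+s} = n^{2s}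
    have h4 : (4 : ℕ) ^ (2 * c) = 2 ^ (4 * c) := by
      rw [show (4 : ℕ) = 2 ^ 2 by norm_num, ← pow_mul]; ring_nf
    have hid : 2 ^ (2 * s) * (2 * (4 * n) ^ (2 * c) * s.factorial * (2 * n) ^ s) =
        (2 ^ (3 * s + 4 * c + 1) * s.factorial) * n ^ (2 * c + s) := by
      rw [mul_pow 4 n, mul_pow 2 n, h4]
      ring
    have hexp : 2 * c + s + 1 = 2 * s := by omega
    have hlt : 2 ^ (2 * s) * (2 * (4 * n) ^ (2 * c) * s.factorial * (2 * n) ^ s) < n ^ (2 * s) := by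
      rw [hid, ← hexp, show n ^ (2 * c + s + 1) = n * n ^ (2 * c + s) from pow_succ' n _]
      exact mul_lt_mul_of_pos_right hnK (pow_pos hnpos _)
    have := lt_of_lt_of_le hlt hpow
    exact Nat.lt_of_mul_lt_mul_left this
  -- combine: (s!)² · LHS < (s! · C(n,s))² = (s!)² · C(n,s)², cancel (s!)²
  have h4 : s.factorial ^ 2 * (2 * (4 * n) ^ (2 * c) * Nat.choose (2 * n) s) <
      s.factorial ^ 2 * (Nat.choose n s) ^ 2 := by
    calc s.factorial ^ 2 * (2 * (4 * n) ^ (2 * c) * Nat.choose (2 * n) s)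
        ≤ 2 * (4 * n) ^ (2 * c) * s.factorial * (2 * n) ^ s := h1
      _ < (n + 1 - s) ^ (2 * s) := h3
      _ ≤ (s.factorial * Nat.choose n s) ^ 2 := h2
      _ = s.factorial ^ 2 * (Nat.choose n s) ^ 2 := by ring
  exact Nat.lt_of_mul_lt_mul_left h4


/-! ## The refutation: thin rows × binary-code columns -/

/-- **The ROABP door's conjecture of record is FALSE** (planner p1 g17, memo HOME/p1/g17/MEMO-roabp-refutation-g17.md).
Given `c, h₀`, take `s = 2c+1`, `n ≥ max(h₀, N(c))`, height `h = 2n`, rows = ALL `s`-subsets of the `x`-coordinates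
(`r = C(2n, s)`), columns = the binary codes of `j < r` on the first `k = ⌈log₂ r⌉ ≤ 2n` `y`-coordinates. For ANY order `π`
and width-`m` certificate with nonzero determinant, cut right after `n` of the `x`-coordinates have been read
(`exists_balanced_cut`): the `C(n, s)` rows supported before the cut and the `C(n, s)` rows supported after it give
`C(n,s) ≤ m · 2^{k₁}` and `C(n,s) ≤ m · 2^{k₂}` with `k₁ + k₂ = k` (`choose_card_pre_le`, `choose_card_suf_le`), so
`C(n,s)² ≤ m² · 2^k ≤ 2 · (4n)^{2c} · C(2n, s)` once `m ≤ (2h)^c = (4n)^c` — contradicting `two_mul_pow_mul_choose_lt`.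
(Nisan's width = cut-rank characterization on a one-sided sub-block; the thin family is rich on both halves of every order.)
Item 19717 itself is untouched (general circuits are not read-once); the door and its class theorems remain certified classes. -/
theorem not_ROABPHitsPartitionMinors : ¬ ROABPHitsPartitionMinors := by
  classical
  rintro ⟨c, h₀, H⟩
  obtain ⟨N, hN⟩ := two_mul_pow_mul_choose_lt c
  set s : ℕ := 2 * c + 1 with hs
  -- the height h = n + n with n large
  obtain ⟨n, hnh₀, hnN, hns⟩ : ∃ n : ℕ, h₀ ≤ n ∧ N ≤ n ∧ s ≤ n :=
    ⟨max (max h₀ N) s, le_trans (le_max_left _ _) (le_max_left _ _),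
      le_trans (le_max_right _ _) (le_max_left _ _), le_max_right _ _⟩
  set hh : ℕ := n + n with hhh
  -- ROWS: all s-subsets of the x-coordinates
  set 𝒰 : Finset (Finset (Fin hh)) := (Finset.univ : Finset (Fin hh)).powersetCard s with h𝒰
  set r : ℕ := 𝒰.card with hr
  have hrc : r = Nat.choose hh s := by
    rw [hr, h𝒰, Finset.card_powersetCard, Finset.card_univ, Fintype.card_fin]
  let eU : ↥𝒰 ≃ Fin r := Fintype.equivFinOfCardEq (Fintype.card_coe 𝒰)
  let u : Fin r → Finset (Fin hh) := fun i => ((eU.symm i : ↥𝒰) : Finset (Fin hh))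
  have hu : Function.Injective u := fun i j hij => eU.symm.injective (Subtype.ext hij)
  have hU : ∀ S : Finset (Fin hh), S.card = s → ∃ i, u i = S := fun S hS =>
    ⟨eU ⟨S, Finset.mem_powersetCard.2 ⟨Finset.subset_univ _, hS⟩⟩, by
      simp only [u, Equiv.symm_apply_apply]⟩
  -- COLUMNS: binary codes on the first k y-coordinates
  have hrpos : 0 < r := by rw [hrc]; exact Nat.choose_pos (by omega)
  set k : ℕ := Nat.clog 2 r with hk
  have hrk : r ≤ 2 ^ k := Nat.le_pow_clog (by norm_num) r
  have h2k : 2 ^ k < 2 * r := by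
    rcases Nat.lt_or_ge 1 r with h1r | hr1
    · have hkpos : 0 < k := Nat.clog_pos (by norm_num) h1r
      have hlt := Nat.pow_pred_clog_lt_self (b := 2) (by norm_num) h1r
      rw [← hk] at hlt
      have hk1 : k.pred + 1 = k := Nat.succ_pred_eq_of_pos hkpos
      have : 2 ^ k = 2 * 2 ^ k.pred := by
        rw [← pow_succ', hk1]
      rw [this]; omega
    · have hr1' : r = 1 := by omega
      have : k = 0 := by rw [hk, hr1', Nat.clog_one_right]
      rw [this]; omega
  have hkh : k ≤ hh := by
    have hlt : 2 ^ k < 2 ^ (hh + 1) := by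
      calc 2 ^ k < 2 * r := h2k
        _ ≤ 2 * 2 ^ hh := by rw [hrc]; exact Nat.mul_le_mul_left 2 (Nat.choose_le_two_pow hh s)
        _ = 2 ^ (hh + 1) := by rw [pow_succ']
    have := (Nat.pow_lt_pow_iff_right (by norm_num : 1 < 2)).1 hlt
    omega
  let w : Fin r → Finset (Fin hh) := fun j =>
    Finset.univ.filter fun y : Fin hh => (y : ℕ) < k ∧ Nat.testBit (j : ℕ) y = true
  have hw : Function.Injective w := by
    intro j₁ j₂ hj
    apply Fin.ext
    apply Nat.eq_of_testBit_eq
    intro i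
    by_cases hi : i < k
    · have hih : i < hh := lt_of_lt_of_le hi hkh
      have := congrArg (fun S : Finset (Fin hh) => (⟨i, hih⟩ : Fin hh) ∈ S) hj
      simp only [w, Finset.mem_filter, Finset.mem_univ, true_and, hi, eq_iff_iff] at this
      exact Bool.eq_iff_iff.2 this
    · have hp : 2 ^ k ≤ 2 ^ i := Nat.pow_le_pow_right (by norm_num) (not_lt.1 hi)
      rw [Nat.testBit_eq_false_of_lt (lt_of_lt_of_le (lt_of_lt_of_le j₁.is_lt hrk) hp),
        Nat.testBit_eq_false_of_lt (lt_of_lt_of_le (lt_of_lt_of_le j₂.is_lt hrk) hp)]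
  -- the conjecture's certificate
  obtain ⟨m, hm, π, P, Q, l, rr, hdet⟩ := H hh (by omega) r u w hu hw
  -- a balanced cut
  obtain ⟨t₀, ht₀⟩ := exists_balanced_cut π n (by omega)
  -- the code coordinates
  set C : Finset (Fin hh) := Finset.univ.filter fun y : Fin hh => (y : ℕ) < k with hC
  have hwC : ∀ j, w j ⊆ C := by
    intro j y hy
    simp only [w, hC, Finset.mem_filter, Finset.mem_univ, true_and] at hy ⊢
    exact hy.1
  have hCcard : C.card = k := by
    have hCim : C = Finset.univ.image (Fin.castLE hkh) := by
      ext y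
      simp only [hC, Finset.mem_filter, Finset.mem_univ, true_and, Finset.mem_image]
      constructor
      · intro hy; exact ⟨⟨y, hy⟩, Fin.ext rfl⟩
      · rintro ⟨z, rfl⟩; exact z.is_lt
    rw [hCim, Finset.card_image_of_injective _ (Fin.castLE_injective hkh), Finset.card_univ, Fintype.card_fin]
  -- the two one-cut bounds
  have hpre := choose_card_pre_le u w π P Q l rr hdet t₀ s C hwC (fun S hS _ => hU S hS)
  have hsuf := choose_card_suf_le u w π P Q l rr hdet t₀ s C hwC (fun S hS _ => hU S hS)
  rw [ht₀] at hpre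
  have hXsuf : (Finset.univ.filter fun a : Fin hh => t₀ ≤ (π.symm (Fin.castAdd hh a) : ℕ)).card = n := by
    have hpart := Finset.card_filter_add_card_filter_not
      (s := (Finset.univ : Finset (Fin hh))) (fun a : Fin hh => (π.symm (Fin.castAdd hh a) : ℕ) < t₀)
    rw [ht₀, Finset.card_univ, Fintype.card_fin] at hpart
    have hcongr : (Finset.univ.filter fun a : Fin hh => ¬ ((π.symm (Fin.castAdd hh a) : ℕ) < t₀)) =
        Finset.univ.filter fun a : Fin hh => t₀ ≤ (π.symm (Fin.castAdd hh a) : ℕ) :=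
      Finset.filter_congr fun a _ => not_lt
    rw [hcongr] at hpart
    omega
  rw [hXsuf] at hsuf
  -- k₁ + k₂ = k
  have hk12 : (C.filter fun y : Fin hh => (π.symm (Fin.natAdd hh y) : ℕ) < t₀).card +
      (C.filter fun y : Fin hh => t₀ ≤ (π.symm (Fin.natAdd hh y) : ℕ)).card = k := by
    have hpart := Finset.card_filter_add_card_filter_not
      (s := C) (fun y : Fin hh => (π.symm (Fin.natAdd hh y) : ℕ) < t₀)
    have hcongr : (C.filter fun y : Fin hh => ¬ ((π.symm (Fin.natAdd hh y) : ℕ) < t₀)) =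
        C.filter fun y : Fin hh => t₀ ≤ (π.symm (Fin.natAdd hh y) : ℕ) :=
      Finset.filter_congr fun a _ => not_lt
    rw [hcongr, hCcard] at hpart
    exact hpart
  -- combine
  have hm' : m ≤ (4 * n) ^ c := by
    have h4 : hh + hh = 4 * n := by omega
    rw [h4] at hm; exact hm
  have hbig : (Nat.choose n s) ^ 2 ≤ 2 * (4 * n) ^ (2 * c) * Nat.choose (2 * n) s := by
    calc (Nat.choose n s) ^ 2 = Nat.choose n s * Nat.choose n s := sq _
      _ ≤ (m * 2 ^ (C.filter fun y : Fin hh => (π.symm (Fin.natAdd hh y) : ℕ) < t₀).card) *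
          (m * 2 ^ (C.filter fun y : Fin hh => t₀ ≤ (π.symm (Fin.natAdd hh y) : ℕ)).card) := Nat.mul_le_mul hpre hsuf
      _ = m ^ 2 * 2 ^ ((C.filter fun y : Fin hh => (π.symm (Fin.natAdd hh y) : ℕ) < t₀).card +
          (C.filter fun y : Fin hh => t₀ ≤ (π.symm (Fin.natAdd hh y) : ℕ)).card) := by rw [pow_add]; ring
      _ = m ^ 2 * 2 ^ k := by rw [hk12]
      _ ≤ m ^ 2 * (2 * r) := Nat.mul_le_mul_left _ h2k.le
      _ ≤ ((4 * n) ^ c) ^ 2 * (2 * r) := Nat.mul_le_mul_right _ (Nat.pow_le_pow_left hm' 2)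
      _ = 2 * (4 * n) ^ (2 * c) * Nat.choose (2 * n) s := by
          rw [hrc, show hh = 2 * n by omega, ← pow_mul, mul_comm c 2]; ring
  exact absurd (hN n hnN) (not_lt.2 hbig)

end Summit.ValiantsHypothesis.Theorems.BarrierLever.RoabpDoor
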